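import Summits.AtomisticToContinuum.HydrodynamicLimit.Theorems.AntiMazurCoboundariesCellForecastPressureDecayEntropyBallObjects
import HarnessLib

/-!
# Entropy tools for the Krylov–Bogoliubov closure: the entropy inequality and relative entropy
# against a conditioned reference (support file of stub `stub_kbClosure`, line
# `entropy-ball-invariant-states` of crux `AntiMazurCoboundaries.CellForecastPressureDecay`,
# stmt-AtomisticToContinuum-13915)

The proof plan of the registered stub `stub_kbClosure :
TorusInfluenceLocality → OneBodyEntropicStiffness → KrylovBogoliubovClosure` (objects module
`…CellForecastPressureDecayEntropyBallObjects`, namespace `…Theorems.EntropyBall`) uses two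
pieces of abstract relative-entropy calculus for Mathlib's `InformationTheory.klDiv`, PROVED here:

* § 1 THE ENTROPY INEQUALITY (Kipnis–Landim 1999, App. 1 §8; Olla–Varadhan–Yau 1993 §1), which
  transfers EQUILIBRIUM exponential-moment bounds (influence locality, Maxwellian tails of
  jumpers) to the almost-invariant states `μ` of the entropy ball `KL(μ | G) ≤ C₀Λ³`:
  `integral_le_toReal_klDiv_add_log` — `∫ f dμ ≤ KL(μ | ν) + log ∫ e^f dν` for probability
  measures with `KL(μ | ν) < ∞`, `f ∈ L¹(μ)`, `e^f ∈ L¹(ν)` (from `0 ≤ KL(μ | ν_f)` for the tilted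
  measure, Mathlib `integral_llr_tilted_right`; the tree's `KipnisLandim1999_A1_8_2_holds` is the
  event instance `f = a𝟙_A` of the same two lines), and `integral_le_inv_mul_klDiv_add_log` — the
  tilted form `E_μ X ≤ lam⁻¹ (KL(μ | ν) + log E_ν e^{lam X})` for bounded measurable `X`, `lam > 0`,
  and `integral_le_inv_mul_klDiv_add_of_lintegral_exp_le` — the same against an exponential-moment
  bound `∫⁻ e^{lam X} dν ≤ e^B` in the `lintegral` format of `TorusInfluenceLocality`;
* § 2 RELATIVE ENTROPY AGAINST A CONDITIONED REFERENCE: `klDiv_eq_klDiv_cond_add` — for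
  probability measures `μ ≪ π(· | A)`, `KL(μ | π) = KL(μ | π(·|A)) + (−log π(A))` in `[0, ∞]`
  (chain rule `dμ/dπ = dμ/dπ(·|A) · π(A)⁻¹𝟙_A`), with the real form `toReal_klDiv_cond_eq`. Its
  instance `π = (unif ⊗ M)^{⊗n}`, `A = D_ε` (so `π(·|A)` is the torus canonical law `torusGibbs`)
  is the entropy decomposition `KL(μ | G) = KL(μ | π_n) + log Z'` of the closure
  (`…KBClosureHelpers.lean`).

Everything here is proved; no new definitions.
-/

noncomputable section

open MeasureTheory ProbabilityTheory Set Filter Topology InformationTheory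
open scoped ENNReal

namespace Summit.AtomisticToContinuum.HydrodynamicLimit.Theorems.EntropyBall

/-! ## § 1 The entropy inequality in the form the closure consumes -/

section EntropyInequality

variable {α : Type*} [MeasurableSpace α] {μ ν : Measure α} [IsProbabilityMeasure μ]
  [IsProbabilityMeasure ν]

/-- **Entropy inequality, log form (Gibbs / Donsker–Varadhan, easy half).** For probability
measures `μ, ν` with `KL(μ | ν) < ∞`, every `μ`-integrable `f` with `e^f` `ν`-integrable
satisfies `∫ f dμ ≤ KL(μ | ν) + log ∫ e^f dν`. Proof: `0 ≤ KL(μ | ν_f)` for the tilted measure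
`ν_f = e^f ν / ∫ e^f dν` (Mathlib `Measure.tilted`, `integral_llr_tilted_right`).
[cite: KipnisLandim1999, Appendix 1 §8 (entropy inequality, p. 338)] -/
theorem integral_le_toReal_klDiv_add_log (hfin : klDiv μ ν ≠ ∞) {f : α → ℝ}
    (hf : Integrable f μ) (hexp : Integrable (fun x => Real.exp (f x)) ν) :
    ∫ x, f x ∂μ ≤ (klDiv μ ν).toReal + Real.log (∫ x, Real.exp (f x) ∂ν) := by
  obtain ⟨hμν, h_int⟩ := klDiv_ne_top_iff.mp hfin
  haveI : IsProbabilityMeasure (ν.tilted f) := isProbabilityMeasure_tilted hexp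
  have hμt : μ ≪ ν.tilted f := hμν.trans (absolutelyContinuous_tilted hexp)
  have h0 : 0 ≤ ∫ x, llr μ (ν.tilted f) x ∂μ := by
    rw [← toReal_klDiv_of_measure_eq hμt (by simp)]
    exact ENNReal.toReal_nonneg
  rw [integral_llr_tilted_right hμν hf hexp h_int,
    ← toReal_klDiv_of_measure_eq hμν (by simp)] at h0
  linarith

/-- **Entropy inequality with a tilt parameter**: for probability measures `μ, ν` with
`KL(μ | ν) < ∞`, a bounded measurable observable `X` and `lam > 0`,
`E_μ X ≤ lam⁻¹ (KL(μ | ν) + log E_ν e^{lam X})` (the form used to transfer equilibrium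
exponential-moment bounds to states of the entropy ball).
[cite: KipnisLandim1999, Appendix 1 §8 (entropy inequality, p. 338)] -/
theorem integral_le_inv_mul_klDiv_add_log (hfin : klDiv μ ν ≠ ∞) {X : α → ℝ}
    (hXm : Measurable X) {C : ℝ} (hXb : ∀ x, |X x| ≤ C) {lam : ℝ} (hlam : 0 < lam) :
    ∫ x, X x ∂μ ≤ lam⁻¹ * ((klDiv μ ν).toReal + Real.log (∫ x, Real.exp (lam * X x) ∂ν)) := by
  have hf : Integrable (fun x => lam * X x) μ := by
    refine (integrable_const (lam * C)).mono' (hXm.const_mul lam).aestronglyMeasurable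
      (ae_of_all _ fun x => ?_)
    rw [Real.norm_eq_abs, abs_mul, abs_of_pos hlam]
    exact mul_le_mul_of_nonneg_left (hXb x) hlam.le
  have hexp : Integrable (fun x => Real.exp (lam * X x)) ν := by
    refine (integrable_const (Real.exp (lam * C))).mono'
      (hXm.const_mul lam).exp.aestronglyMeasurable (ae_of_all _ fun x => ?_)
    rw [Real.norm_eq_abs, abs_of_pos (Real.exp_pos _), Real.exp_le_exp]
    refine (le_abs_self _).trans ?_
    rw [abs_mul, abs_of_pos hlam]
    exact mul_le_mul_of_nonneg_left (hXb x) hlam.le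
  have h := integral_le_toReal_klDiv_add_log hfin hf hexp
  rw [integral_const_mul] at h
  rw [le_inv_mul_iff₀ hlam]
  exact h

/-- **Entropy inequality against an exponential-moment bound in `lintegral` form** (the format of
`TorusInfluenceLocality`: `∫⁻ e^{lam X} dν ≤ e^B`): for probability measures `μ, ν` with
`KL(μ | ν) < ∞`, a bounded measurable `X`, `lam > 0` and `∫⁻ ofReal (e^{lam X}) dν ≤ ofReal (e^B)`,
`E_μ X ≤ lam⁻¹ (KL(μ | ν) + B)`. [folklore] -/
theorem integral_le_inv_mul_klDiv_add_of_lintegral_exp_le (hfin : klDiv μ ν ≠ ∞) {X : α → ℝ}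
    (hXm : Measurable X) {C : ℝ} (hXb : ∀ x, |X x| ≤ C) {lam : ℝ} (hlam : 0 < lam) {B : ℝ}
    (hB : ∫⁻ x, ENNReal.ofReal (Real.exp (lam * X x)) ∂ν ≤ ENNReal.ofReal (Real.exp B)) :
    ∫ x, X x ∂μ ≤ lam⁻¹ * ((klDiv μ ν).toReal + B) := by
  have hexp : Integrable (fun x => Real.exp (lam * X x)) ν := by
    refine (integrable_const (Real.exp (lam * C))).mono'
      (hXm.const_mul lam).exp.aestronglyMeasurable (ae_of_all _ fun x => ?_)
    rw [Real.norm_eq_abs, abs_of_pos (Real.exp_pos _), Real.exp_le_exp]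
    refine (le_abs_self _).trans ?_
    rw [abs_mul, abs_of_pos hlam]
    exact mul_le_mul_of_nonneg_left (hXb x) hlam.le
  have hpos : 0 < ∫ x, Real.exp (lam * X x) ∂ν := integral_exp_pos hexp
  have hle : ∫ x, Real.exp (lam * X x) ∂ν ≤ Real.exp B := by
    rw [← ENNReal.ofReal_le_ofReal_iff (Real.exp_pos B).le,
      ofReal_integral_eq_lintegral_ofReal hexp (ae_of_all _ fun x => (Real.exp_pos _).le)]
    exact hB
  have hlog : Real.log (∫ x, Real.exp (lam * X x) ∂ν) ≤ B := by
    rw [← Real.log_exp B]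
    exact Real.log_le_log hpos hle
  refine (integral_le_inv_mul_klDiv_add_log hfin hXm hXb hlam).trans ?_
  exact mul_le_mul_of_nonneg_left (by linarith) (inv_nonneg.2 hlam.le)

end EntropyInequality

/-! ## § 2 Relative entropy against a conditioned reference -/

section Conditioning

variable {α : Type*} [MeasurableSpace α] {μ π : Measure α} [IsProbabilityMeasure μ]
  [IsProbabilityMeasure π] {A : Set α}

/-- **Relative entropy against a conditioned reference (the entropy decomposition
`KL(μ | π) = KL(μ | π(·|A)) − log π(A)`).** For probability measures `μ`, `π`, an event `A`
with `π A ≠ 0` and `μ ≪ π(· | A)`: `KL(μ | π) = KL(μ | π(·|A)) + (−log π(A))` in `[0, ∞]`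
(both sides are `∞` together). Proof: `dπ(·|A)/dπ = π(A)⁻¹ 𝟙_A`, chain rule for
Radon–Nikodym derivatives, `μ` is carried by `A`. [folklore] -/
theorem klDiv_eq_klDiv_cond_add (hA : MeasurableSet A) (hπA : π A ≠ 0) (hμ : μ ≪ π[|A]) :
    klDiv μ π = klDiv μ (π[|A]) + ENNReal.ofReal (-Real.log (π.real A)) := by
  haveI : IsProbabilityMeasure (π[|A]) := cond_isProbabilityMeasure hπA
  have hAtop : π A ≠ ∞ := measure_ne_top π A
  have hdens : π[|A] = π.withDensity (fun x => (π A)⁻¹ * A.indicator 1 x) := by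
    rw [ProbabilityTheory.cond, ← withDensity_indicator_one hA,
      ← withDensity_smul _ (measurable_one.indicator hA)]
    rfl
  have hGπ : π[|A] ≪ π := by
    rw [hdens]
    exact withDensity_absolutelyContinuous _ _
  have hμπ : μ ≪ π := hμ.trans hGπ
  have h1 : (π[|A]).rnDeriv π =ᵐ[π] fun x => (π A)⁻¹ * A.indicator 1 x := by
    rw [hdens]
    exact Measure.rnDeriv_withDensity _ (measurable_const.mul (measurable_one.indicator hA))
  have h2 : μ.rnDeriv (π[|A]) * (π[|A]).rnDeriv π =ᵐ[π] μ.rnDeriv π :=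
    Measure.rnDeriv_mul_rnDeriv hμ
  have h3 : ∀ᵐ x ∂μ, 0 < μ.rnDeriv (π[|A]) x := Measure.rnDeriv_pos hμ
  have h4 : ∀ᵐ x ∂μ, μ.rnDeriv (π[|A]) x < ∞ := hμ.ae_le (Measure.rnDeriv_lt_top μ _)
  have h5 : ∀ᵐ x ∂μ, x ∈ A := by
    have hG : (π[|A]) Aᶜ = 0 := by
      rw [ProbabilityTheory.cond, Measure.smul_apply, Measure.restrict_apply hA.compl,
        Set.compl_inter_self, measure_empty, smul_zero]
    have hμAc : μ Aᶜ = 0 := hμ hG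
    filter_upwards [measure_eq_zero_iff_ae_notMem.1 hμAc] with x hx
    simpa using hx
  have hkey : llr μ π =ᵐ[μ] fun x => llr μ (π[|A]) x + -Real.log (π.real A) := by
    filter_upwards [hμπ.ae_le h1, hμπ.ae_le h2, h3, h4, h5] with x hx1 hx2 hx3 hx4 hx5
    simp only [llr]
    rw [← hx2, Pi.mul_apply, hx1, Set.indicator_of_mem hx5, Pi.one_apply, mul_one,
      ENNReal.toReal_mul, ENNReal.toReal_inv, Real.log_mul (ENNReal.toReal_pos hx3.ne' hx4.ne).ne'
        (inv_ne_zero (ENNReal.toReal_pos hπA hAtop).ne'), Real.log_inv, measureReal_def]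
  have hlog : 0 ≤ -Real.log (π.real A) := by
    rw [neg_nonneg]
    exact Real.log_nonpos measureReal_nonneg measureReal_le_one
  by_cases hint : Integrable (llr μ (π[|A])) μ
  · have hint' : Integrable (llr μ π) μ := by
      rw [integrable_congr hkey]
      exact hint.add (integrable_const _)
    have hnn : 0 ≤ ∫ x, llr μ (π[|A]) x ∂μ := by
      rw [← toReal_klDiv_of_measure_eq hμ (by simp)]
      exact ENNReal.toReal_nonneg
    rw [← ENNReal.ofReal_toReal (klDiv_ne_top hμπ hint'),
      ← ENNReal.ofReal_toReal (klDiv_ne_top hμ hint), toReal_klDiv_of_measure_eq hμπ (by simp),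
      toReal_klDiv_of_measure_eq hμ (by simp), integral_congr_ae hkey,
      integral_add hint (integrable_const _), integral_const, smul_eq_mul, probReal_univ, one_mul,
      ENNReal.ofReal_add hnn hlog]
  · have hint' : ¬Integrable (llr μ π) μ := fun h => hint (by
      rw [integrable_congr hkey] at h
      exact integrable_add_const_iff.1 h)
    rw [klDiv_of_not_integrable hint, klDiv_of_not_integrable hint', top_add]

/-- The real-valued form of `klDiv_eq_klDiv_cond_add` when the entropies are finite:
`KL(μ | π(·|A)) = KL(μ | π) + log π(A)`. [folklore] -/
theorem toReal_klDiv_cond_eq (hA : MeasurableSet A) (hπA : π A ≠ 0) (hμ : μ ≪ π[|A])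
    (hfin : klDiv μ (π[|A]) ≠ ∞) :
    (klDiv μ (π[|A])).toReal = (klDiv μ π).toReal + Real.log (π.real A) := by
  have hlog : 0 ≤ -Real.log (π.real A) := by
    rw [neg_nonneg]
    exact Real.log_nonpos measureReal_nonneg measureReal_le_one
  rw [klDiv_eq_klDiv_cond_add hA hπA hμ, ENNReal.toReal_add hfin ENNReal.ofReal_ne_top,
    ENNReal.toReal_ofReal hlog]
  ring

end Conditioning

/-- S3-track helper stub (line entropy-ball-invariant-states): the entropy inequality for Mathlib's
`klDiv` in log form, in tilted form for bounded measurable observables, and against a `lintegral`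
exponential-moment bound; relative entropy against a conditioned reference
`KL(μ | π) = KL(μ | π(·|A)) + (−log π(A))` and its real form. -/
theorem stub_kbEntropyTools :
    (∀ (α : Type) [MeasurableSpace α] (μ ν : Measure α) [IsProbabilityMeasure μ] [IsProbabilityMeasure ν], klDiv μ ν ≠ ∞ → ∀ f : α → ℝ, Integrable f μ → Integrable (fun x => Real.exp (f x)) ν → ∫ x, f x ∂μ ≤ (klDiv μ ν).toReal + Real.log (∫ x, Real.exp (f x) ∂ν)) ∧ (∀ (α : Type) [MeasurableSpace α] (μ ν : Measure α) [IsProbabilityMeasure μ] [IsProbabilityMeasure ν], klDiv μ ν ≠ ∞ → ∀ (X : α → ℝ), Measurable X → ∀ C : ℝ, (∀ x, |X x| ≤ C) → ∀ lam : ℝ, 0 < lam → ∫ x, X x ∂μ ≤ lam⁻¹ * ((klDiv μ ν).toReal + Real.log (∫ x, Real.exp (lam * X x) ∂ν))) ∧ (∀ (α : Type) [MeasurableSpace α] (μ ν : Measure α) [IsProbabilityMeasure μ] [IsProbabilityMeasure ν], klDiv μ ν ≠ ∞ → ∀ (X : α → ℝ), Measurable X → ∀ C : ℝ, (∀ x,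 |X x| ≤ C) → ∀ lam : ℝ, 0 < lam → ∀ B : ℝ, ∫⁻ x, ENNReal.ofReal (Real.exp (lam * X x)) ∂ν ≤ ENNReal.ofReal (Real.exp B) → ∫ x, X x ∂μ ≤ lam⁻¹ * ((klDiv μ ν).toReal + B)) ∧ (∀ (α : Type) [MeasurableSpace α] (μ π : Measure α) [IsProbabilityMeasure μ] [IsProbabilityMeasure π] (A : Set α), MeasurableSet A → π A ≠ 0 → μ ≪ π[|A] → klDiv μ π = klDiv μ (π[|A]) + ENNReal.ofReal (-Real.log (π.real A))) ∧ (∀ (α : Type) [MeasurableSpace α] (μ π : Measure α) [IsProbabilityMeasure μ] [IsProbabilityMeasure π] (A : Set α), MeasurableSet A → π A ≠ 0 → μ ≪ π[|A] → klDiv μ (π[|A]) ≠ ∞ → (klDiv μ (π[|A])).toReal = (klDiv μ π).toReal + Real.log (π.real A)) :=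
  ⟨fun _ _ _ _ _ _ hfin _ hf hexp => integral_le_toReal_klDiv_add_log hfin hf hexp,
    fun _ _ _ _ _ _ hfin _ hXm _ hXb _ hlam => integral_le_inv_mul_klDiv_add_log hfin hXm hXb hlam,
    fun _ _ _ _ _ _ hfin _ hXm _ hXb _ hlam _ hB =>
      integral_le_inv_mul_klDiv_add_of_lintegral_exp_le hfin hXm hXb hlam hB,
    fun _ _ _ _ _ _ _ hA hπA hμ => klDiv_eq_klDiv_cond_add hA hπA hμ,
    fun _ _ _ _ _ _ _ hA hπA hμ hfin => toReal_klDiv_cond_eq hA hπA hμ hfin⟩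

end Summit.AtomisticToContinuum.HydrodynamicLimit.Theorems.EntropyBall

end
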